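import Mathlib
import Summits.ResolutionOfSingularities.ResolutionOfSingularities.Theorems.WeightedInvariantHypersurfaceLocalGameEFTDimTwoFace
import Summits.ResolutionOfSingularities.ResolutionOfSingularities.Theorems.WeightedInvariantHypersurfaceLocalGameEFTDimTwoAxisOrderHasse
import HarnessLib

/-!
# The order of a weighted face form with COPRIME weights off the vertex (door `HypersurfaceCentreConstruction`, (o25-β))

Topic: `Summits/ResolutionOfSingularities/ResolutionOfSingularities/Theorems`. Helper for the door item
`HypersurfaceCentreConstruction` (statement `stmt-ResolutionOfSingularities-19897`, route `WeightedInvariant`), line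
`local-engine` of `res-L1-w43-plan-1`, ORDER (o25-β) (DEALS gen 9 #21, 2026-08-27T09:27:57Z) «order drop on `B₊` for
GENERAL COPRIME WEIGHTS» = clause (3) of the named fact `AbramovichQuekSchober2025_heightTwoCentre`
(`Literature/…/HypersurfaceHeightTwoWeightedCentre.lean`) in kernel, FIELD PART: the generalisation of res-type-078's K4
(`LocalGameEFTFace.algebraMap_face_notMem_pow`, weights `(1, b)`, p508084) to weights `(w₀, w₁)` coprime.

[OURS · L1 W4.3] Replaces the role of NO printed item of the manuscript under review [claim: Hironaka2017,
status: under-review]; it re-proves, in the tree's vocabulary, the field step of Abramovich–Quek–Schober 2025, Thm 1.3 (3)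
(«`f_{J,1}(x₁', x₂') = x₁'^ν + ⋯` is not a pure `ν`-th power … thus its order of vanishing at any point on this locus is
`< ν`», arXiv:2507.01232v3 p. 12). AI work, weaker than expert review.

## Statement (`algebraMap_lexFace_notMem_pow`; `κ` ANY field)

Let `w₀, w₁ ≥ 1` be coprime, `ν ≥ 1`, and `P = Σ_j c_j s^j ∈ κ[s]` with `w₁ · deg P ≤ ν`, `c₀ ≠ 0`, `deg P ≥ 1`, and `P` not
`c (s - λ)^ν`. The `(w₀, w₁)`-WEIGHTED FACE FORM `Φ = Σ_j c_j X₀^{ν - w₁ j} X₁^{w₀ j}` (the monomials of weight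
`w₀α₀ + w₁α₁ = w₀ν`; coprimality forces `α₁ = w₀ j`) satisfies `Φ ∉ 𝔪_𝔫^ν κ[X₀,X₁]_𝔫` at every prime `𝔫 ⊉ (X₀, X₁)`:
* chart `X₁ ∈ 𝔫`: `Φ ≡ c₀ X₀^ν (mod X₁)` is a unit (`c₀ ≠ 0`);
* chart `X₀ ∈ 𝔫 ∌ X₁`: `Φ = X₀^{ν - w₁ D} · (c_D X₁^{w₀ D} + X₀ ·(…))` with `D = deg P ≥ 1`, order `ν - w₁ D < ν` (res-D-pv-014's
  axis order `LocalGameEFTAxisOrder.algebraMap_mul_X_pow_not_mem_maximalIdeal_pow`, p510293);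
* chart `X₀, X₁ ∉ 𝔫` (`algebraMap_lexFace_notMem_pow_of_notMem`): a MONOMIAL CHANGE OF TORUS COORDINATES — Bezout
  `w₀ q = w₁ r + 1`, `s = X₁^{w₀} X₀^{-w₁}`, `t = X₀^{q} X₁^{-r}`, so `X₀ = s^r t^{w₀}`, `X₁ = s^q t^{w₁}` and
  `Φ = t^{w₀ν} s^{rν} P(s)` — puts us in the situation of 078's K4 core: through `θ : κ[X₀,X₁] → S[T]`, `S = κ[s]_𝔭`,
  `ψ : S[T] → κ[X₀,X₁]_𝔫`, res-type-073's fibre lemma `mem_maximalIdeal_pow_of_mul_C_mem_pow` (p501481) gives `P ∈ 𝔪_S^ν`,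
  excluded by 078's PID step `LocalGameEFTFace.algebraMap_notMem_pow_atPrime`.
(For `w₁ ≥ 2` the hypothesis «`P ≠ c (s - λ)^ν`» is automatic from `deg P ≤ ν / w₁ < ν`; for `w₁ = 1` it is the
genuine exception — the STEEPENABLE face — which lex-maximality of the centre excludes in (o25-β)'s assembly.)

## References

* D. Abramovich, M. H. Quek, B. Schober, *Torus actions, weighted blow-ups, and desingularization of plane curves*,
  arXiv:2507.01232 (v3, 2026), Thm 1.3 (3), Cor. 3.6, §5. [AbramovichQuekSchober2025]
* J. Włodarczyk, *Functorial resolution by torus actions*, arXiv:2203.03090, §2.3.9. [Wlodarczyk2022]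
-/

noncomputable section

open IsLocalRing Polynomial

set_option linter.dupNamespace false -- mandated namespace of this single-conjunct summit

namespace Summit.ResolutionOfSingularities.ResolutionOfSingularities.Theorems

namespace LexMaxOrderDrop

open Summit.ResolutionOfSingularities.ResolutionOfSingularities.Cruxes.HypersurfaceCentreConstruction.LocalEngine
  (mem_maximalIdeal_pow_of_mul_C_mem_pow)

universe u

variable {κ : Type u} [Field κ]

/-! ### Bezout in `ℕ` for coprime weights -/

/-- For coprime `w₀, w₁` with `w₁ ≥ 1` there are `q, r ∈ ℕ` with `w₀ q = w₁ r + 1`. [folklore] -/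
theorem exists_mul_eq_mul_add_one {w₀ w₁ : ℕ} (hcop : Nat.Coprime w₀ w₁) (h₀ : 0 < w₀) (h₁ : 0 < w₁) :
    ∃ q r : ℕ, w₀ * q = w₁ * r + 1 := by
  rcases Nat.lt_or_ge 1 w₁ with h | h
  · obtain ⟨m, -, hm⟩ := Nat.exists_mul_mod_eq_one_of_coprime hcop h
    refine ⟨m, w₀ * m / w₁, ?_⟩
    have := Nat.div_add_mod (w₀ * m) w₁
    rw [hm] at this
    exact this.symm
  · have hw₁ : w₁ = 1 := le_antisymm h h₁
    subst hw₁
    exact ⟨1, w₀ - 1, by omega⟩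

/-- The monomial bookkeeping of the torus chart: under `X₀ ↦ s^r T^{w₀}`, `X₁ ↦ s^q T^{w₁}` with `w₀ q = w₁ r + 1`, the face
monomial `a X₀^{ν - w₁ j} X₁^{w₀ j}` (`w₁ j ≤ ν`) becomes `T^{w₀ν} · s^{rν} · (a s^j)`. [folklore] -/
theorem face_monomial_theta {A : Type*} [CommRing A] (s a : A) {r q w₀ w₁ ν j : ℕ} (hqr : w₀ * q = w₁ * r + 1)
    (hj : w₁ * j ≤ ν) :
    Polynomial.C a * (Polynomial.C (s ^ r) * X ^ w₀) ^ (ν - w₁ * j) * (Polynomial.C (s ^ q) * X ^ w₁) ^ (w₀ * j) =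
      X ^ (w₀ * ν) * Polynomial.C (s ^ (r * ν)) * Polynomial.C (a * s ^ j) := by
  have es : r * (ν - w₁ * j) + q * (w₀ * j) = r * ν + j := by
    have h1 : r * (w₁ * j) ≤ r * ν := Nat.mul_le_mul_left _ hj
    have h2 : q * (w₀ * j) = r * (w₁ * j) + j := by
      have : q * (w₀ * j) = (w₀ * q) * j := by ring
      rw [this, hqr]; ring
    rw [Nat.mul_sub, h2]; omega
  have et : w₀ * (ν - w₁ * j) + w₁ * (w₀ * j) = w₀ * ν := by
    have h1 : w₀ * (w₁ * j) ≤ w₀ * ν := Nat.mul_le_mul_left _ hj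
    have h2 : w₁ * (w₀ * j) = w₀ * (w₁ * j) := by ring
    rw [Nat.mul_sub, h2]; omega
  rw [mul_pow, mul_pow, ← Polynomial.C_pow, ← Polynomial.C_pow, ← pow_mul, ← pow_mul, ← pow_mul, ← pow_mul]
  have h : Polynomial.C a * (Polynomial.C (s ^ (r * (ν - w₁ * j))) * X ^ (w₀ * (ν - w₁ * j))) *
      (Polynomial.C (s ^ (q * (w₀ * j))) * X ^ (w₁ * (w₀ * j))) =
      X ^ (w₀ * (ν - w₁ * j) + w₁ * (w₀ * j)) * Polynomial.C (s ^ (r * (ν - w₁ * j) + q * (w₀ * j))) *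
        Polynomial.C a := by
    rw [pow_add, pow_add, Polynomial.C_mul]; ring
  rw [h, et, es, pow_add, Polynomial.C_mul, Polynomial.C_mul]; ring

/-! ### The face form and its charts -/

/-- On the chart `X₁ ∈ 𝔫` (so `X₀ ∉ 𝔫` off the vertex) the face form `Φ ≡ c₀ X₀^ν (mod X₁)` with `c₀ ≠ 0` lies outside `𝔫`.
[folklore] -/
theorem lexFace_notMem_of_mem {w₀ w₁ ν : ℕ} (hw₀ : 0 < w₀) {P : κ[X]} (hP0 : P.coeff 0 ≠ 0)
    {Φ : MvPolynomial (Fin 2) κ}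
    (hΦ : Φ = ∑ j ∈ Finset.range (P.natDegree + 1),
      MvPolynomial.C (P.coeff j) * MvPolynomial.X 0 ^ (ν - w₁ * j) * MvPolynomial.X 1 ^ (w₀ * j))
    (𝔫 : Ideal (MvPolynomial (Fin 2) κ)) [𝔫.IsPrime] (h1 : MvPolynomial.X 1 ∈ 𝔫) (h0 : MvPolynomial.X 0 ∉ 𝔫) :
    Φ ∉ 𝔫 := by
  classical
  intro hΦ𝔫
  -- `Φ = c₀ X₀^ν + X₁ · H`
  set H : MvPolynomial (Fin 2) κ := ∑ j ∈ Finset.Ico 1 (P.natDegree + 1),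
    MvPolynomial.C (P.coeff j) * MvPolynomial.X 0 ^ (ν - w₁ * j) * MvPolynomial.X 1 ^ (w₀ * j - 1) with hH
  have hsplit : Φ = MvPolynomial.C (P.coeff 0) * MvPolynomial.X 0 ^ ν + MvPolynomial.X 1 * H := by
    rw [hΦ, Finset.range_eq_Ico, Finset.sum_eq_sum_Ico_succ_bot (Nat.succ_pos _), mul_zero, mul_zero, Nat.sub_zero,
      pow_zero, mul_one, hH, Finset.mul_sum]
    congr 1
    refine Finset.sum_congr rfl fun j hj => ?_
    have hj1 : 1 ≤ j := (Finset.mem_Ico.mp hj).1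
    have h1' : 1 ≤ w₀ * j := Nat.one_le_iff_ne_zero.mpr (Nat.mul_ne_zero (by omega) (by omega))
    conv_lhs => rw [← Nat.sub_add_cancel h1', pow_succ]
    ring
  have hX : MvPolynomial.C (P.coeff 0) * MvPolynomial.X 0 ^ ν ∈ 𝔫 := by
    have h := Ideal.sub_mem _ hΦ𝔫 (Ideal.mul_mem_right H _ h1)
    rwa [hsplit, add_sub_cancel_right] at h
  rcases (‹𝔫.IsPrime›).mem_or_mem hX with hC | hX0
  · exact (‹𝔫.IsPrime›).ne_top (Ideal.eq_top_of_isUnit_mem _ hC ((isUnit_iff_ne_zero.mpr hP0).map MvPolynomial.C))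
  · exact h0 ((‹𝔫.IsPrime›).mem_of_pow_mem ν hX0)

/-- On the chart `X₀ ∈ 𝔫 ∌ X₁`: `Φ = X₀^{ν - w₁ D} · Ψ` with `D = deg P ≥ 1`, `Ψ ≡ c_D X₁^{w₀ D} (mod X₀)` outside `𝔫`, so
`Φ ∉ 𝔪_𝔫^{ν - w₁ D + 1} ⊇ 𝔪_𝔫^ν` (res-D-pv-014's axis order). [cite: Wlodarczyk2022, §2.3.9] -/
theorem algebraMap_lexFace_notMem_pow_of_mem {w₀ w₁ ν : ℕ} (hw₁ : 0 < w₁) {P : κ[X]}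
    (hdeg : w₁ * P.natDegree ≤ ν) (hP1 : 0 < P.natDegree) {Φ : MvPolynomial (Fin 2) κ}
    (hΦ : Φ = ∑ j ∈ Finset.range (P.natDegree + 1),
      MvPolynomial.C (P.coeff j) * MvPolynomial.X 0 ^ (ν - w₁ * j) * MvPolynomial.X 1 ^ (w₀ * j))
    (𝔫 : Ideal (MvPolynomial (Fin 2) κ)) [𝔫.IsPrime] (h0 : MvPolynomial.X 0 ∈ 𝔫) (h1 : MvPolynomial.X 1 ∉ 𝔫) :
    algebraMap (MvPolynomial (Fin 2) κ) (Localization.AtPrime 𝔫) Φ ∉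
      maximalIdeal (Localization.AtPrime 𝔫) ^ ν := by
  classical
  set D := P.natDegree with hD
  -- `Φ = Ψ · X₀^{ν - w₁ D}`
  set Ψ : MvPolynomial (Fin 2) κ := ∑ j ∈ Finset.range (D + 1),
    MvPolynomial.C (P.coeff j) * MvPolynomial.X 0 ^ (w₁ * (D - j)) * MvPolynomial.X 1 ^ (w₀ * j) with hΨ
  have hsplit : Φ = Ψ * MvPolynomial.X 0 ^ (ν - w₁ * D) := by
    rw [hΦ, hΨ, Finset.sum_mul]
    refine Finset.sum_congr rfl fun j hj => ?_
    have hjD : j ≤ D := Nat.lt_succ_iff.mp (Finset.mem_range.mp hj)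
    have h : ν - w₁ * j = w₁ * (D - j) + (ν - w₁ * D) := by
      rw [Nat.mul_sub]
      have : w₁ * j ≤ w₁ * D := Nat.mul_le_mul_left _ hjD
      omega
    rw [h, pow_add]
    ring
  -- `Ψ ∉ 𝔫`: `Ψ = c_D X₁^{w₀ D} + X₀ · H`
  have hΨ𝔫 : Ψ ∉ 𝔫 := by
    intro hmem
    set H : MvPolynomial (Fin 2) κ := ∑ j ∈ Finset.range D,
      MvPolynomial.C (P.coeff j) * MvPolynomial.X 0 ^ (w₁ * (D - j) - 1) * MvPolynomial.X 1 ^ (w₀ * j) with hH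
    have hsplitΨ : Ψ = MvPolynomial.C (P.coeff D) * MvPolynomial.X 1 ^ (w₀ * D) + MvPolynomial.X 0 * H := by
      rw [hΨ, Finset.sum_range_succ, Nat.sub_self, mul_zero, pow_zero, mul_one, add_comm, hH, Finset.mul_sum]
      congr 1
      refine Finset.sum_congr rfl fun j hj => ?_
      have hj' : j < D := Finset.mem_range.mp hj
      have h1' : 1 ≤ w₁ * (D - j) := Nat.one_le_iff_ne_zero.mpr (Nat.mul_ne_zero (by omega) (by omega))
      conv_lhs => rw [← Nat.sub_add_cancel h1', pow_succ]
      ring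
    have hX : MvPolynomial.C (P.coeff D) * MvPolynomial.X 1 ^ (w₀ * D) ∈ 𝔫 := by
      have h := Ideal.sub_mem _ hmem (Ideal.mul_mem_right H _ h0)
      rwa [hsplitΨ, add_sub_cancel_right] at h
    rcases (‹𝔫.IsPrime›).mem_or_mem hX with hC | hX1
    · have hPD : P.coeff D ≠ 0 := by
        rw [hD]
        exact Polynomial.leadingCoeff_ne_zero.mpr (Polynomial.ne_zero_of_natDegree_gt hP1)
      exact (‹𝔫.IsPrime›).ne_top (Ideal.eq_top_of_isUnit_mem _ hC ((isUnit_iff_ne_zero.mpr hPD).map MvPolynomial.C))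
    · exact h1 ((‹𝔫.IsPrime›).mem_of_pow_mem _ hX1)
  -- axis order: `Ψ · X₀^{ν - w₁ D} ∉ 𝔪^{ν - w₁ D + 1} ⊇ 𝔪^ν`
  intro hmem
  have hle : ν - w₁ * D + 1 ≤ ν := by
    have : 1 ≤ w₁ * D := Nat.one_le_iff_ne_zero.mpr (Nat.mul_ne_zero (by omega) (by omega))
    omega
  rw [hsplit] at hmem
  exact LocalGameEFTAxisOrder.algebraMap_mul_X_pow_not_mem_maximalIdeal_pow (Localization.AtPrime 𝔫) h0 hΨ𝔫 _
    (Ideal.pow_le_pow_right hle hmem)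

/-- **The torus chart `X₀, X₁ ∉ 𝔫`** (both variables units): with Bezout `w₀ q = w₁ r + 1` the monomial change of torus
coordinates `s = X₁^{w₀} X₀^{-w₁}`, `t = X₀^{q} X₁^{-r}` (`X₀ = s^r t^{w₀}`, `X₁ = s^q t^{w₁}`) writes `Φ = t^{w₀ν} s^{rν} P(s)`;
078's K4 mechanism (`θ : κ[X₀,X₁] → S[T]`, `S = κ[s]_𝔭`, `ψ : S[T] → κ[X₀,X₁]_𝔫`, 073's fibre lemma, the PID step) then
gives `Φ ∉ 𝔪_𝔫^ν` unless `P = c (s - λ)^ν` (`deg P ≤ ν`). [cite: AbramovichQuekSchober2025, §5 (proof of Thm 1.3 (3))] -/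
theorem algebraMap_lexFace_notMem_pow_of_notMem {w₀ w₁ ν : ℕ} (hw₀ : 0 < w₀) (hw₁ : 0 < w₁) (hcop : Nat.Coprime w₀ w₁)
    (hν : 1 ≤ ν) {P : κ[X]} (hdegν : P.natDegree ≤ ν) (hdeg : w₁ * P.natDegree ≤ ν)
    (hP : ¬ ∃ c l : κ, P = C c * (X - C l) ^ ν) {Φ : MvPolynomial (Fin 2) κ}
    (hΦ : Φ = ∑ j ∈ Finset.range (P.natDegree + 1),
      MvPolynomial.C (P.coeff j) * MvPolynomial.X 0 ^ (ν - w₁ * j) * MvPolynomial.X 1 ^ (w₀ * j))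
    (𝔫 : Ideal (MvPolynomial (Fin 2) κ)) [𝔫.IsPrime] (h0 : MvPolynomial.X 0 ∉ 𝔫) (h1 : MvPolynomial.X 1 ∉ 𝔫) :
    algebraMap (MvPolynomial (Fin 2) κ) (Localization.AtPrime 𝔫) Φ ∉
      maximalIdeal (Localization.AtPrime 𝔫) ^ ν := by
  classical
  obtain ⟨q, r, hqr⟩ := exists_mul_eq_mul_add_one hcop hw₀ hw₁
  intro hmem
  set L := Localization.AtPrime 𝔫
  -- the units `x₀, x₁`
  have hx0 : IsUnit (algebraMap (MvPolynomial (Fin 2) κ) L (MvPolynomial.X 0)) :=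
    IsLocalization.map_units (M := 𝔫.primeCompl) L ⟨MvPolynomial.X 0, h0⟩
  have hx1 : IsUnit (algebraMap (MvPolynomial (Fin 2) κ) L (MvPolynomial.X 1)) :=
    IsLocalization.map_units (M := 𝔫.primeCompl) L ⟨MvPolynomial.X 1, h1⟩
  set x0 : Lˣ := hx0.unit with hx0def
  set x1 : Lˣ := hx1.unit with hx1def
  have hx0_coe : (x0 : L) = algebraMap (MvPolynomial (Fin 2) κ) L (MvPolynomial.X 0) := hx0.unit_spec
  have hx1_coe : (x1 : L) = algebraMap (MvPolynomial (Fin 2) κ) L (MvPolynomial.X 1) := hx1.unit_spec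
  -- the torus coordinates `s = x₁^{w₀} x₀^{-w₁}`, `t = x₀^{q} x₁^{-r}`
  set sL : L := (x1 : L) ^ w₀ * ((x0⁻¹ : Lˣ) : L) ^ w₁ with hsL
  set tL : L := (x0 : L) ^ q * ((x1⁻¹ : Lˣ) : L) ^ r with htL
  have hsL_unit : IsUnit sL := (x1.isUnit.pow _).mul ((x0⁻¹).isUnit.pow _)
  have htL_unit : IsUnit tL := (x0.isUnit.pow _).mul ((x1⁻¹).isUnit.pow _)
  -- `x₀ = s^r t^{w₀}`, `x₁ = s^q t^{w₁}`
  have hinv0 : ((x0⁻¹ : Lˣ) : L) * (x0 : L) = 1 := Units.inv_mul x0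
  have hinv1 : ((x1⁻¹ : Lˣ) : L) * (x1 : L) = 1 := Units.inv_mul x1
  have hX0eq : sL ^ r * tL ^ w₀ = (x0 : L) := by
    -- exponents: x₁^{w₀ r - r w₀} x₀^{-w₁ r + q w₀} = x₀
    rw [hsL, htL, mul_pow, mul_pow, ← pow_mul, ← pow_mul, ← pow_mul, ← pow_mul]
    have e1 : q * w₀ = w₁ * r + 1 := by rw [mul_comm]; exact hqr
    calc (x1 : L) ^ (w₀ * r) * ((x0⁻¹ : Lˣ) : L) ^ (w₁ * r) * ((x0 : L) ^ (q * w₀) * ((x1⁻¹ : Lˣ) : L) ^ (r * w₀))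
        = ((x1 : L) ^ (w₀ * r) * ((x1⁻¹ : Lˣ) : L) ^ (w₀ * r)) *
            (((x0⁻¹ : Lˣ) : L) ^ (w₁ * r) * (x0 : L) ^ (w₁ * r)) * (x0 : L) := by
          rw [e1, pow_succ, show r * w₀ = w₀ * r from mul_comm _ _]; ring
      _ = (x0 : L) := by
          rw [← mul_pow, ← mul_pow, mul_comm (x1 : L), hinv1, hinv0, one_pow, one_pow, one_mul, one_mul]
  have hX1eq : sL ^ q * tL ^ w₁ = (x1 : L) := by
    rw [hsL, htL, mul_pow, mul_pow, ← pow_mul, ← pow_mul, ← pow_mul, ← pow_mul]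
    have e1 : w₀ * q = r * w₁ + 1 := by rw [mul_comm r]; exact hqr
    calc (x1 : L) ^ (w₀ * q) * ((x0⁻¹ : Lˣ) : L) ^ (w₁ * q) * ((x0 : L) ^ (q * w₁) * ((x1⁻¹ : Lˣ) : L) ^ (r * w₁))
        = ((x1 : L) ^ (r * w₁) * ((x1⁻¹ : Lˣ) : L) ^ (r * w₁)) *
            (((x0⁻¹ : Lˣ) : L) ^ (w₁ * q) * (x0 : L) ^ (w₁ * q)) * (x1 : L) := by
          rw [e1, pow_succ, show q * w₁ = w₁ * q from mul_comm _ _]; ring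
      _ = (x1 : L) := by
          rw [← mul_pow, ← mul_pow, mul_comm (x1 : L) ((x1⁻¹ : Lˣ) : L), hinv1, hinv0, one_pow, one_pow, one_mul,
            one_mul]
  -- `σ₀ : κ[s] → L`, `s ↦ sL`; `S = κ[s]_𝔭`
  set σ₀ : κ[X] →+* L := Polynomial.eval₂RingHom
    ((algebraMap (MvPolynomial (Fin 2) κ) L).comp MvPolynomial.C) sL with hσ₀
  set 𝔭 : Ideal κ[X] := (maximalIdeal L).comap σ₀ with h𝔭
  haveI h𝔭prime : 𝔭.IsPrime := Ideal.comap_isPrime σ₀ _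
  set S := Localization.AtPrime 𝔭 with hS
  have hunits : ∀ y : 𝔭.primeCompl, IsUnit (σ₀ y) := fun y => by
    by_contra hnu
    exact y.2 (Ideal.mem_comap.mpr ((IsLocalRing.mem_maximalIdeal _).mpr hnu))
  set σ : S →+* L := IsLocalization.lift (M := 𝔭.primeCompl) hunits with hσ
  have hσ_alg : ∀ p : κ[X], σ (algebraMap κ[X] S p) = σ₀ p := fun p => IsLocalization.lift_eq hunits p
  have hσ₀C : ∀ c : κ, σ₀ (Polynomial.C c) = algebraMap (MvPolynomial (Fin 2) κ) L (MvPolynomial.C c) := fun c => by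
    rw [hσ₀, Polynomial.coe_eval₂RingHom, Polynomial.eval₂_C, RingHom.comp_apply]
  have hσ₀X : σ₀ X = sL := by rw [hσ₀, Polynomial.coe_eval₂RingHom, Polynomial.eval₂_X]
  -- `s ∉ 𝔭` (its image is a unit), so `s` is a unit of `S`
  have hs𝔭 : (X : κ[X]) ∉ 𝔭 := fun h => by
    rw [h𝔭, Ideal.mem_comap, hσ₀X] at h
    exact (IsLocalRing.mem_maximalIdeal _).mp h hsL_unit
  set sS : S := algebraMap κ[X] S X with hsS
  have hsS_unit : IsUnit sS := IsLocalization.map_units (M := 𝔭.primeCompl) S ⟨X, hs𝔭⟩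
  have hσsS : σ sS = sL := by rw [hsS, hσ_alg, hσ₀X]
  -- `ψ : S[T] → L`, `T ↦ tL`
  set ψ : S[X] →+* L := Polynomial.eval₂RingHom σ tL with hψ
  have hψC : ∀ p : S, ψ (Polynomial.C p) = σ p := fun p => by
    rw [hψ, Polynomial.coe_eval₂RingHom, Polynomial.eval₂_C]
  have hψX : ψ X = tL := by rw [hψ, Polynomial.coe_eval₂RingHom, Polynomial.eval₂_X]
  -- `θ : κ[X₀,X₁] → S[T]`, `X₀ ↦ s^r T^{w₀}`, `X₁ ↦ s^q T^{w₁}`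
  set g : Fin 2 → S[X] := ![Polynomial.C (sS ^ r) * X ^ w₀, Polynomial.C (sS ^ q) * X ^ w₁] with hg
  set θ : MvPolynomial (Fin 2) κ →+* S[X] :=
    MvPolynomial.eval₂Hom (Polynomial.C.comp ((algebraMap κ[X] S).comp Polynomial.C)) g with hθ
  have hθC : ∀ c : κ, θ (MvPolynomial.C c) = Polynomial.C (algebraMap κ[X] S (Polynomial.C c)) := fun c => by
    rw [hθ, MvPolynomial.eval₂Hom_C, RingHom.comp_apply, RingHom.comp_apply]
  have hθX0 : θ (MvPolynomial.X 0) = Polynomial.C (sS ^ r) * X ^ w₀ := by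
    rw [hθ, MvPolynomial.eval₂Hom_X', hg]; rfl
  have hθX1 : θ (MvPolynomial.X 1) = Polynomial.C (sS ^ q) * X ^ w₁ := by
    rw [hθ, MvPolynomial.eval₂Hom_X', hg]; rfl
  -- `ψ ∘ θ = algebraMap`
  have hψθ : ψ.comp θ = algebraMap (MvPolynomial (Fin 2) κ) L := by
    refine MvPolynomial.ringHom_ext (fun c => ?_) (fun k => ?_)
    · rw [RingHom.comp_apply, hθC, hψC, hσ_alg, hσ₀C]
    · rw [RingHom.comp_apply]
      fin_cases k
      · show ψ (θ (MvPolynomial.X 0)) = algebraMap (MvPolynomial (Fin 2) κ) L (MvPolynomial.X 0)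
        rw [hθX0, map_mul, hψC, map_pow, map_pow, hψX, hσsS, hX0eq, hx0_coe]
      · show ψ (θ (MvPolynomial.X 1)) = algebraMap (MvPolynomial (Fin 2) κ) L (MvPolynomial.X 1)
        rw [hθX1, map_mul, hψC, map_pow, map_pow, hψX, hσsS, hX1eq, hx1_coe]
  have hψθ' : ∀ F : MvPolynomial (Fin 2) κ, ψ (θ F) = algebraMap (MvPolynomial (Fin 2) κ) L F := fun F => by
    rw [← RingHom.comp_apply, hψθ]
  -- `θ Φ = T^{w₀ν} · C(s^{rν}) · C(P)`
  have hθΦ : θ Φ = X ^ (w₀ * ν) * Polynomial.C (sS ^ (r * ν)) * Polynomial.C (algebraMap κ[X] S P) := by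
    have hPsum : P = ∑ j ∈ Finset.range (P.natDegree + 1), Polynomial.C (P.coeff j) * X ^ j := by
      conv_lhs => rw [P.as_sum_range' (P.natDegree + 1) (Nat.lt_succ_self _)]
      simp only [Polynomial.C_mul_X_pow_eq_monomial]
    rw [hΦ, map_sum]
    conv_rhs => rw [hPsum, map_sum, map_sum, Finset.mul_sum]
    refine Finset.sum_congr rfl fun j hj => ?_
    have hjD : j ≤ P.natDegree := Nat.lt_succ_iff.mp (Finset.mem_range.mp hj)
    have hjν : w₁ * j ≤ ν := (Nat.mul_le_mul_left _ hjD).trans hdeg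
    rw [map_mul, map_mul, map_pow, map_pow, hθC, hθX0, hθX1,
      face_monomial_theta sS ((algebraMap κ[X] S) (Polynomial.C (P.coeff j))) hqr hjν]
    simp only [map_mul, map_pow, ← hsS]
  -- `𝔮 = ψ⁻¹ 𝔪_L`, `𝔮 ∩ S = 𝔪_S`
  set 𝔮 : Ideal S[X] := (maximalIdeal L).comap ψ with h𝔮def
  haveI : 𝔮.IsPrime := Ideal.comap_isPrime ψ _
  have h𝔮 : 𝔮.comap (Polynomial.C : S →+* S[X]) = maximalIdeal S := by
    have hcomp : 𝔮.comap (Polynomial.C : S →+* S[X]) = (maximalIdeal L).comap σ := by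
      rw [h𝔮def, Ideal.comap_comap]
      congr 1
      exact RingHom.ext fun p => by rw [RingHom.comp_apply, hψC]
    rw [hcomp]
    have hne : (maximalIdeal L).comap σ ≠ ⊤ := (Ideal.comap_isPrime σ (maximalIdeal L)).ne_top
    have hle : maximalIdeal S ≤ (maximalIdeal L).comap σ := by
      rw [← Localization.AtPrime.map_eq_maximalIdeal, Ideal.map_le_iff_le_comap, Ideal.comap_comap,
        IsLocalization.lift_comp]
    exact ((IsLocalRing.maximalIdeal.isMaximal S).eq_of_le hne hle).symm
  -- `θ 𝔫 ⊆ 𝔮`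
  have hθ𝔫 : 𝔫.map θ ≤ 𝔮 := by
    rw [Ideal.map_le_iff_le_comap]
    intro n hn
    rw [Ideal.mem_comap, h𝔮def, Ideal.mem_comap, hψθ']
    exact (IsLocalization.AtPrime.to_map_mem_maximal_iff L 𝔫 n).mpr hn
  -- `G Φ ∈ 𝔫^ν` with `G ∉ 𝔫`
  rw [← Localization.AtPrime.map_eq_maximalIdeal, ← Ideal.map_pow,
    IsLocalization.algebraMap_mem_map_algebraMap_iff 𝔫.primeCompl] at hmem
  obtain ⟨G, hG, hGΦ⟩ := hmem
  have hG' : G ∉ 𝔫 := hG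
  -- `u = θ G · T^{w₀ν} · C(s^{rν}) ∉ 𝔮` and `u · C(P) ∈ 𝔮^ν`
  have hu : θ G * X ^ (w₀ * ν) * Polynomial.C (sS ^ (r * ν)) ∉ 𝔮 := by
    intro h
    rcases (‹𝔮.IsPrime›).mem_or_mem h with h12 | h3
    · rcases (‹𝔮.IsPrime›).mem_or_mem h12 with h1' | h2
      · rw [h𝔮def, Ideal.mem_comap, hψθ'] at h1'
        exact hG' ((IsLocalization.AtPrime.to_map_mem_maximal_iff L 𝔫 G).mp h1')
      · have hX𝔮 := (‹𝔮.IsPrime›).mem_of_pow_mem _ h2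
        rw [h𝔮def, Ideal.mem_comap, hψX] at hX𝔮
        exact (IsLocalRing.mem_maximalIdeal _).mp hX𝔮 htL_unit
    · rw [h𝔮def, Ideal.mem_comap, hψC, map_pow, hσsS] at h3
      exact (IsLocalRing.mem_maximalIdeal _).mp h3 (hsL_unit.pow _)
  have huP : θ G * X ^ (w₀ * ν) * Polynomial.C (sS ^ (r * ν)) * Polynomial.C (algebraMap κ[X] S P) ∈ 𝔮 ^ ν := by
    rw [mul_assoc, mul_assoc, ← mul_assoc (X ^ (w₀ * ν)), ← hθΦ, ← map_mul]
    exact Ideal.pow_right_mono hθ𝔫 ν (by rw [← Ideal.map_pow]; exact Ideal.mem_map_of_mem θ hGΦ)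
  -- 073's fibre lemma, then 078's PID step
  exact LocalGameEFTFace.algebraMap_notMem_pow_atPrime hν hdegν hP 𝔭 (mem_maximalIdeal_pow_of_mul_C_mem_pow 𝔮 h𝔮 hu huP)

/-- **The weighted face form with coprime weights has order `< ν` off the vertex** ((o25-β) field step = AQS Thm 1.3 (3)
on the exceptional divisor). `κ` any field; `w₀, w₁ ≥ 1` coprime; `ν ≥ 1`; `P = Σ_j c_j s^j ∈ κ[s]` with `w₁ · deg P ≤ ν`,
`c₀ ≠ 0`, `deg P ≥ 1` and `P ≠ c (s - λ)^ν`; `Φ = Σ_j c_j X₀^{ν - w₁ j} X₁^{w₀ j}`. Then at every prime `𝔫 ⊉ (X₀, X₁)`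
of `κ[X₀, X₁]`, `Φ ∉ 𝔪_𝔫^ν`. [cite: AbramovichQuekSchober2025, Thm 1.3 (3), §5] -/
theorem algebraMap_lexFace_notMem_pow {w₀ w₁ ν : ℕ} (hw₀ : 0 < w₀) (hw₁ : 0 < w₁) (hcop : Nat.Coprime w₀ w₁)
    (hν : 1 ≤ ν) {P : κ[X]} (hdeg : w₁ * P.natDegree ≤ ν) (hP0 : P.coeff 0 ≠ 0) (hP1 : 0 < P.natDegree)
    (hP : ¬ ∃ c l : κ, P = C c * (X - C l) ^ ν) {Φ : MvPolynomial (Fin 2) κ}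
    (hΦ : Φ = ∑ j ∈ Finset.range (P.natDegree + 1),
      MvPolynomial.C (P.coeff j) * MvPolynomial.X 0 ^ (ν - w₁ * j) * MvPolynomial.X 1 ^ (w₀ * j))
    (𝔫 : Ideal (MvPolynomial (Fin 2) κ)) [𝔫.IsPrime]
    (hvert : ¬ Ideal.span {(MvPolynomial.X 0 : MvPolynomial (Fin 2) κ), MvPolynomial.X 1} ≤ 𝔫) :
    algebraMap (MvPolynomial (Fin 2) κ) (Localization.AtPrime 𝔫) Φ ∉
      maximalIdeal (Localization.AtPrime 𝔫) ^ ν := by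
  have hdegν : P.natDegree ≤ ν := le_trans (Nat.le_mul_of_pos_left _ hw₁) hdeg
  by_cases h0 : (MvPolynomial.X 0 : MvPolynomial (Fin 2) κ) ∈ 𝔫
  · have h1 : (MvPolynomial.X 1 : MvPolynomial (Fin 2) κ) ∉ 𝔫 := fun h1 => hvert (by
      rw [Ideal.span_le, Set.insert_subset_iff, Set.singleton_subset_iff]
      exact ⟨h0, h1⟩)
    exact algebraMap_lexFace_notMem_pow_of_mem hw₁ hdeg hP1 hΦ 𝔫 h0 h1
  · by_cases h1 : (MvPolynomial.X 1 : MvPolynomial (Fin 2) κ) ∈ 𝔫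
    · have hΦ𝔫 : Φ ∉ 𝔫 := lexFace_notMem_of_mem hw₀ hP0 hΦ 𝔫 h1 h0
      intro hmem
      have hunit : IsUnit (algebraMap (MvPolynomial (Fin 2) κ) (Localization.AtPrime 𝔫) Φ) :=
        IsLocalization.map_units (M := 𝔫.primeCompl) _ ⟨Φ, hΦ𝔫⟩
      exact (IsLocalRing.mem_maximalIdeal _).mp (Ideal.pow_le_self (by omega) hmem) hunit
    · exact algebraMap_lexFace_notMem_pow_of_notMem hw₀ hw₁ hcop hν hdegν hdeg hP hΦ 𝔫 h0 h1

end LexMaxOrderDrop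

end Summit.ResolutionOfSingularities.ResolutionOfSingularities.Theorems

end
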